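import Summits.QuantumAdvantage.QuantumAdvantage.Theorems.LinnikCubicClassGroupsDegreeOnePrimesEscapeQuarticS4Group
import Summits.QuantumAdvantage.QuantumAdvantage.Theorems.LinnikCubicClassGroupsDegreeOnePrimesEscapeQuarticS4Count
import Summits.QuantumAdvantage.QuantumAdvantage.Theorems.LinnikCubicClassGroupsDegreeOnePrimesEscapeQuarticS4Closure
import Summits.QuantumAdvantage.QuantumAdvantage.Theorems.LinnikCubicClassGroupsDegreeOnePrimesEscapeCubicSplittingPrimes
import HarnessLib

/-!
# The least inert prime of an `S₄`-quartic field is `≤ |d_K|^L`, unconditionally — by upper bounds only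

Topic `Summits/QuantumAdvantage/QuantumAdvantage/Theorems`, cell B2b-1 (linnik-cubic), PART A (gen 8);
helper toward the crux `DegreeOnePrimesEscape` (stmt-QuantumAdvantage-11543) of route
`LinnikCubicClassGroups`.  HONEST FRAMING: the value of this file is a THEOREM (kernel-checked, GRH-free,
Siegel-free, no hypothesis) — NOT summit progress (the route still rests on the hypothesis-type target
`PureCubicClassNumberHard`).

**Theorem** (`exists_inertPrime_le_of_quartic_S4`).  There is an absolute `L > 0` such that every
quartic number field `K` whose Galois closure has group `S₄` (phrased intrinsically: every Galois number
field into which `K` embeds has degree `≥ 24`) has a rational prime `p ≤ |d_K|^{L}` that is INERT in `K`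
(`p𝓞_K` prime), i.e. whose Frobenius is a 4-cycle.  This is the Lagarias–Montgomery–Odlyzko theorem
[LagariasMontgomeryOdlyzko1979] for the class of 4-cycles of `S₄`; explicit exponents are known in print
(Cho–Lemke Oliver–Zaman 2025, `α(S₄, C) = 1/6 + ε`), so this file is an INDEPENDENT KERNEL-CHECKED
CERTIFICATION with an inexplicit exponent, by a different and very short route:

Proof — ONE-SIDED, no lower bound for any number field.  Let `N ⊃ K' ≅ K` be the Galois closure
(`quarticS4Closure`: degree `24`, `ψ : Gal(N/ℚ) ≃ S₄` with `Gal(N/K') = Stab(0)`, `|d_N| ≤ |d_K|^{24}`), and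
`k = N^{A₄}`, `K₃ = N^{D₈}` (`exists_quartic_subgroups`).  The class function
`f = 7 − 2·Ind_{A₄}1 − Ind_{D₈}1 − 3·Ind_{S₃}1` on `S₄` satisfies `f ≤ 6·𝟙[4-cycle]` POINTWISE
(`…QuarticS4Group.lean`, `decide`), so prime by prime (`quartic_dictionary`, Perlis' unramified
dictionary) and summed over `p ≤ x` (`seven_mul_quarticInertSum_ge`):

  `7 θ(x) − 2 θ¹_k(x) − θ¹_{K₃}(x) − 3 θ¹_{K'}(x) − 7 log|d_N| ≤ 7 Σ_{p ≤ x inert in K', p ∤ d_N} log p`.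

Now ONLY `θ(x) ≥ (1 − η)x` (prime number theorem) and the UPPER bounds `θ¹_E(x) ≤ θ_E(x) ≤ (1 + η)x`,
valid uniformly for `x ≥ Q_E^{a(n_E, η)}` (`chebyshevThetaIdeal_le_uniform`, degrees `2, 3, 4`), are
needed: with `η = 1/26` the left side is `≥ x/2 − 7 log|d_N| > 0` for `x = |d_K|^L`.  Exceptional zeros
never enter (they only decrease prime counts), in contrast with the 3-cycles of `S₃`
(`…CubicInertPrime.lean`), where no such one-sided domination exists and a Deuring–Heilbronn case
analysis was necessary.

Placement (presearch 2026-08-19): known in print with explicit exponents — LMO 1979; P. J. Cho,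
R. J. Lemke Oliver, A. Zaman, *The least prime with a given cycle type*, arXiv:2512.24963 (2025), Thm. 8
(`α(S₄,C) = 1/6`), whose "contradictory pair" method (`Ψ₊` with a pole vs `Ψ₋` entire, convexity) is a
different mechanism in the same Vinogradov spirit.  New here is only the kernel-checked proof.

References: J. C. Lagarias, H. L. Montgomery, A. M. Odlyzko, Invent. Math. 54 (1979) 271–296
[LagariasMontgomeryOdlyzko1979]; J. Thorner, A. Zaman, Algebra Number Theory 13 (2019) [ThornerZaman2019];
R. Perlis, J. Number Theory 9 (1977) [Perlis1977].
-/

noncomputable section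

open scoped NumberField nonZeroDivisors
open Finset Real Ideal NumberField
open Literature.NumberTheory.NumberFields Literature.NumberTheory.LFunctions
  Literature.NumberTheory.LFunctions.NumberField

namespace Summit.QuantumAdvantage.QuantumAdvantage.Theorems.DegreeOnePrimesEscape

/-! ### The summed one-sided dictionary -/

section Summed

variable {N : Type} [Field N] [NumberField N] [IsGalois ℚ N]

/-- **Inert primes of an `S₄`-quartic field, summed over `p ≤ x`**: under the hypotheses of
`quartic_dictionary` (`|A| = 12`, `|D| = 8`, `|Gal(N/K')| = 6` and the group inequality),
`7 θ(x) − 2 θ¹_{N^A}(x) − θ¹_{N^D}(x) − 3 θ¹_{K'}(x) − 7 log|d_N| ≤ 7 Σ_{p ≤ x, p ∤ d_N, p inert in K'} log p`,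
"inert" being recorded as `Σ_{𝔭 ∣ p, f(𝔭|p) ∣ 2} f(𝔭|p) = 0`. -/
theorem seven_mul_quarticInertSum_ge (A D : Subgroup (N ≃ₐ[ℚ] N)) (K' : IntermediateField ℚ N)
    (hA : Nat.card A = 12) (hD : Nat.card D = 8) (hS : Nat.card K'.fixingSubgroup = 6)
    (hineq : ∀ x : N ≃ₐ[ℚ] N, 168 ≤ 4 * Nat.card {g : N ≃ₐ[ℚ] N // g * x * g⁻¹ ∈ A} +
        3 * Nat.card {g : N ≃ₐ[ℚ] N // g * x * g⁻¹ ∈ D} +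
        12 * Nat.card {g : N ≃ₐ[ℚ] N // g * x * g⁻¹ ∈ K'.fixingSubgroup} +
        (if Nat.card {g : N ≃ₐ[ℚ] N // g * x * g⁻¹ ∈ K'.fixingSubgroup} = 0 ∧
            Nat.card {g : N ≃ₐ[ℚ] N // g * (x * x) * g⁻¹ ∈ K'.fixingSubgroup} = 0 then 144 else 0))
    (x : ℝ) :
    7 * Chebyshev.theta x - 2 * degreeOneTheta (IntermediateField.fixedField A) x -
        degreeOneTheta (IntermediateField.fixedField D) x - 3 * degreeOneTheta K' x -
        7 * Real.log ((NumberField.discr N).natAbs : ℝ) ≤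
      7 * ∑ p ∈ (Nat.primesLE ⌊x⌋₊).filter
        (fun p : ℕ => ¬ ((p : ℤ) ∣ NumberField.discr N) ∧
          ((splittingType K' p).filter (· ∣ 2)).sum = 0), Real.log p := by
  classical
  set k := IntermediateField.fixedField A with hk_def
  set K₃ := IntermediateField.fixedField D with hK₃_def
  have h := sum_le_of_pointwise (N := N) 7 (by norm_num)
    (fun p => 7 - 2 * (((splittingType k p).count 1 : ℕ) : ℝ) - (((splittingType K₃ p).count 1 : ℕ) : ℝ)
      - 3 * (((splittingType K' p).count 1 : ℕ) : ℝ))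
    (fun p => ((splittingType K' p).filter (· ∣ 2)).sum = 0) ⌊x⌋₊ ?_ ?_
  · rw [Chebyshev.theta_eq_sum_primesLE, degreeOneTheta_eq_sum_count_one,
      degreeOneTheta_eq_sum_count_one, degreeOneTheta_eq_sum_count_one]
    refine le_trans (le_of_eq ?_) h
    rw [Finset.mul_sum, Finset.mul_sum, Finset.mul_sum, ← Finset.sum_sub_distrib,
      ← Finset.sum_sub_distrib, ← Finset.sum_sub_distrib]
    refine congrArg₂ _ (Finset.sum_congr rfl fun p _ => by ring) rfl
  · intro p hp hd
    have hp' := (Nat.mem_primesLE.mp hp).2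
    have hdict := quartic_dictionary A D K' hA hD hS hineq hp' hd
    split_ifs at hdict ⊢ with h0
    · have : (7 : ℝ) ≤ 2 * (((splittingType k p).count 1 : ℕ) : ℝ) +
          (((splittingType K₃ p).count 1 : ℕ) : ℝ) + 3 * (((splittingType K' p).count 1 : ℕ) : ℝ) + 6 := by
        exact_mod_cast hdict
      linarith
    · have : (7 : ℝ) ≤ 2 * (((splittingType k p).count 1 : ℕ) : ℝ) +
          (((splittingType K₃ p).count 1 : ℕ) : ℝ) + 3 * (((splittingType K' p).count 1 : ℕ) : ℝ) := by
        exact_mod_cast hdict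
      linarith
  · intro p _ _
    have h1 : (0 : ℝ) ≤ (((splittingType k p).count 1 : ℕ) : ℝ) := Nat.cast_nonneg _
    have h2 : (0 : ℝ) ≤ (((splittingType K₃ p).count 1 : ℕ) : ℝ) := Nat.cast_nonneg _
    have h3 : (0 : ℝ) ≤ (((splittingType K' p).count 1 : ℕ) : ℝ) := Nat.cast_nonneg _
    linarith

end Summed

/-! ### Thresholds -/

/-- `Q_E = |d_E| n_E^{n_E} ≤ d^{30}` for a field of degree `≤ 4` with `|d_E| ≤ d^{24}`, `d ≥ 3`. -/
private theorem condQn_le_pow_thirty {E : Type*} [Field E] [NumberField E] {d : ℝ} (hd : 3 ≤ d)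
    (hE : ((NumberField.discr E).natAbs : ℝ) ≤ d ^ (24 : ℕ)) (hn : Module.finrank ℚ E ≤ 4) :
    ThornerZaman.condQn E ≤ d ^ (30 : ℝ) := by
  have hd0 : 0 < d := by linarith
  have h30 : d ^ (30 : ℝ) = d ^ (24 : ℕ) * d ^ (6 : ℕ) := by
    rw [show (30 : ℝ) = ((30 : ℕ) : ℝ) by norm_num, Real.rpow_natCast]; ring
  have hnn : ((Module.finrank ℚ E : ℕ) : ℝ) ^ Module.finrank ℚ E ≤ 256 := by
    have h1 : ((Module.finrank ℚ E : ℕ) : ℝ) ^ Module.finrank ℚ E ≤ (4 : ℝ) ^ Module.finrank ℚ E :=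
      pow_le_pow_left₀ (Nat.cast_nonneg _) (by exact_mod_cast hn) _
    have h2 : (4 : ℝ) ^ Module.finrank ℚ E ≤ (4 : ℝ) ^ 4 := pow_le_pow_right₀ (by norm_num) hn
    linarith [h1, h2, show (4 : ℝ) ^ 4 = 256 by norm_num]
  have hd6 : (256 : ℝ) ≤ d ^ (6 : ℕ) := by
    have : (3 : ℝ) ^ (6 : ℕ) ≤ d ^ (6 : ℕ) := pow_le_pow_left₀ (by norm_num) hd 6
    nlinarith
  rw [ThornerZaman.condQn, ← Int.cast_abs, Int.abs_eq_natAbs, Int.cast_natCast, h30]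
  exact mul_le_mul hE (hnn.trans hd6) (by positivity) (by positivity)

/-! ### The theorem -/

set_option maxHeartbeats 800000 in
/-- **The least inert prime of an `S₄`-quartic field, unconditionally** (Chebotarev–Linnik for the
4-cycles of `S₄`): there is `L > 0` such that every quartic number field `K` all of whose Galois
splitting fields have degree `≥ 24` (equivalently: with Galois closure of group `S₄`) has a rational
prime `p ≤ |d_K|^{L}` with `p𝓞_K` prime.  GRH-free, Siegel-free, no hypothesis; proved with UPPER
bounds for the auxiliary fields only. [cite: LagariasMontgomeryOdlyzko1979, Theorem 1.1] -/
theorem exists_inertPrime_le_of_quartic_S4 :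
    ∃ L : ℝ, 0 < L ∧ ∀ (K : Type) [Field K] [NumberField K], Module.finrank ℚ K = 4 →
      (∀ (M : Type) [Field M] [NumberField M] [IsGalois ℚ M],
        (K →ₐ[ℚ] M) → 24 ≤ Module.finrank ℚ M) →
        ∃ p : ℕ, p.Prime ∧ (p : ℝ) ≤ ((NumberField.discr K).natAbs : ℝ) ^ L ∧
          (Ideal.span {(p : 𝓞 K)}).IsPrime := by
  classical
  -- constants
  obtain ⟨a₂, ha₂, hup2⟩ := chebyshevThetaIdeal_le_uniform 2 (by norm_num) (η := 1 / 26) (by norm_num)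
  obtain ⟨a₃, ha₃, hup3⟩ := chebyshevThetaIdeal_le_uniform 3 (by norm_num) (η := 1 / 26) (by norm_num)
  obtain ⟨a₄, ha₄, hup4⟩ := chebyshevThetaIdeal_le_uniform 4 (by norm_num) (η := 1 / 26) (by norm_num)
  obtain ⟨x₀, hx₀2, hθQ⟩ := chebyshevTheta_eventually_ge (η := 1 / 26) (by norm_num)
  set a : ℝ := max a₂ (max a₃ a₄) with ha_def
  have ha2 : a₂ ≤ a := le_max_left _ _
  have ha3 : a₃ ≤ a := le_trans (le_max_left _ _) (le_max_right _ _)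
  have ha4 : a₄ ≤ a := le_trans (le_max_right _ _) (le_max_right _ _)
  have ha1 : 1 ≤ a := le_trans ha₂ ha2
  obtain ⟨L, hL, hthr⟩ := exists_exponent_rpow 30 a x₀ 400 (by norm_num) (by linarith)
  refine ⟨L, hL, fun K _ _ h4 hS4 => ?_⟩
  -- the closure and the three subfields
  obtain ⟨N, _, _, hGal, h24, K', e, ψ, hstab, hdN⟩ := quarticS4Closure K h4 hS4
  haveI := hGal
  obtain ⟨A, D, hA, hD, hS, hineq⟩ := exists_quartic_subgroups ψ K'.fixingSubgroup hstab
  set k := IntermediateField.fixedField A with hk_def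
  set K₃ := IntermediateField.fixedField D with hK₃_def
  have hk : Module.finrank ℚ k = 2 := by
    have h1 : Module.finrank k N = 12 := by
      rw [hk_def, IntermediateField.finrank_fixedField_eq_card, hA]
    have h2 := Module.finrank_mul_finrank ℚ k N
    rw [h1, h24] at h2
    omega
  have hK₃ : Module.finrank ℚ K₃ = 3 := by
    have h1 : Module.finrank K₃ N = 8 := by
      rw [hK₃_def, IntermediateField.finrank_fixedField_eq_card, hD]
    have h2 := Module.finrank_mul_finrank ℚ K₃ N
    rw [h1, h24] at h2
    omega
  have hK' : Module.finrank ℚ K' = 4 := by rw [← e.toLinearEquiv.finrank_eq, h4]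
  have hdisc' : NumberField.discr K' = NumberField.discr K :=
    (NumberField.discr_eq_discr_of_algEquiv K e).symm
  -- sizes
  set d : ℝ := ((NumberField.discr K).natAbs : ℝ) with hd
  have hd3 : (3 : ℝ) ≤ d := three_le_natAbs_discr_real K (by rw [h4]; norm_num)
  have hd0 : (0 : ℝ) < d := by linarith
  obtain ⟨hx₀, hxQ, hxB⟩ := hthr d hd3
  set x : ℝ := d ^ L with hx
  -- discriminants and conductors of the subfields
  have hdE : ∀ E : IntermediateField ℚ N, ((NumberField.discr E).natAbs : ℝ) ≤ d ^ (24 : ℕ) := by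
    intro E
    have hdvd := NumberField.discr_dvd_discr E N
    have h1 : (NumberField.discr E).natAbs ≤ (NumberField.discr N).natAbs :=
      Nat.le_of_dvd (Int.natAbs_pos.mpr (NumberField.discr_ne_zero N)) (Int.natAbs_dvd_natAbs.mpr hdvd)
    rw [hd]
    exact_mod_cast h1.trans hdN
  have hd30 : (1 : ℝ) ≤ d ^ (30 : ℝ) := Real.one_le_rpow (by linarith) (by norm_num)
  have hQx : ∀ (E : IntermediateField ℚ N) (b : ℝ), 0 ≤ b → b ≤ a → Module.finrank ℚ E ≤ 4 →
      ThornerZaman.condQn E ^ b ≤ x := by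
    intro E b hb hba hn
    have hQ := condQn_le_pow_thirty hd3 (hdE E) hn
    have hQ0 : 0 ≤ ThornerZaman.condQn E := by
      rw [ThornerZaman.condQn]; positivity
    calc ThornerZaman.condQn E ^ b ≤ (d ^ (30 : ℝ)) ^ b := Real.rpow_le_rpow hQ0 hQ (hb)
      _ ≤ (d ^ (30 : ℝ)) ^ a := Real.rpow_le_rpow_of_exponent_le hd30 hba
      _ ≤ x := hxQ
  -- the analytic inputs at `x`
  have hθ : 25 / 26 * x ≤ Chebyshev.theta x := by
    have := hθQ x hx₀; norm_num at this ⊢; linarith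
  have hθk : degreeOneTheta k x ≤ 27 / 26 * x := by
    have := (degreeOneTheta_le_chebyshevThetaIdeal k x).trans
      (hup2 k hk x (hQx k a₂ (by linarith) ha2 (by omega)))
    norm_num at this ⊢; linarith
  have hθ3 : degreeOneTheta K₃ x ≤ 27 / 26 * x := by
    have := (degreeOneTheta_le_chebyshevThetaIdeal K₃ x).trans
      (hup3 K₃ hK₃ x (hQx K₃ a₃ (by linarith) ha3 (by omega)))
    norm_num at this ⊢; linarith
  have hθK : degreeOneTheta K' x ≤ 27 / 26 * x := by
    have := (degreeOneTheta_le_chebyshevThetaIdeal K' x).trans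
      (hup4 K' hK' x (hQx K' a₄ (by linarith) ha4 hK'.le))
    norm_num at this ⊢; linarith
  have hlogN : 7 * Real.log ((NumberField.discr N).natAbs : ℝ) < x / 2 := by
    have := log_natAbs_discr_le hdN
    push_cast at this
    linarith
  -- the sum is positive
  have hsum := seven_mul_quarticInertSum_ge A D K' hA hD hS hineq x
  have hpos : 0 < ∑ p ∈ (Nat.primesLE ⌊x⌋₊).filter
      (fun p : ℕ => ¬ ((p : ℤ) ∣ NumberField.discr N) ∧
        ((splittingType K' p).filter (· ∣ 2)).sum = 0), Real.log p := by
    linarith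
  obtain ⟨p, hp, hpx, hpN, hcount⟩ := exists_prime_of_sum_log_pos hpos
  -- passing from `K'` to `K`
  have hdvd : ¬ ((p : ℤ) ∣ NumberField.discr K) := fun h =>
    hpN (h.trans (hdisc' ▸ NumberField.discr_dvd_discr K' N))
  refine ⟨p, hp, hpx, isPrime_span_of_sum_filter_dvd_two_eq_zero h4 hp hdvd ?_⟩
  rw [ArithmeticallyEquivalent.of_algEquiv e p hp]
  exact hcount

/-! ### The number of inert primes in the Linnik range -/

set_option maxHeartbeats 800000 in
open scoped Classical in
/-- **Inert primes of an `S₄`-quartic field have the expected order of magnitude in the Linnik range**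
(a Chebotarev lower bound of the right order for the 4-cycles of `S₄`, `θ`-form): there is `L > 0` such
that for every quartic field `K` with Galois closure of group `S₄` and every `x ≥ |d_K|^L`,
`x / 16 ≤ Σ_{p ≤ x, p𝓞_K prime} log p`.  Same one-sided proof as `exists_inertPrime_le_of_quartic_S4`,
with `x` free. [cite: LagariasMontgomeryOdlyzko1979, Theorem 1.1] [cite: ThornerZaman2019, Theorem 1.1] -/
theorem inertSum_ge_of_quartic_S4 :
    ∃ L : ℝ, 0 < L ∧ ∀ (K : Type) [Field K] [NumberField K], Module.finrank ℚ K = 4 →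
      (∀ (M : Type) [Field M] [NumberField M] [IsGalois ℚ M],
        (K →ₐ[ℚ] M) → 24 ≤ Module.finrank ℚ M) →
        ∀ x : ℝ, ((NumberField.discr K).natAbs : ℝ) ^ L ≤ x →
          x / 16 ≤ ∑ p ∈ (Nat.primesLE ⌊x⌋₊).filter
            (fun p : ℕ => (Ideal.span {(p : 𝓞 K)}).IsPrime), Real.log p := by
  -- constants
  obtain ⟨a₂, ha₂, hup2⟩ := chebyshevThetaIdeal_le_uniform 2 (by norm_num) (η := 1 / 26) (by norm_num)
  obtain ⟨a₃, ha₃, hup3⟩ := chebyshevThetaIdeal_le_uniform 3 (by norm_num) (η := 1 / 26) (by norm_num)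
  obtain ⟨a₄, ha₄, hup4⟩ := chebyshevThetaIdeal_le_uniform 4 (by norm_num) (η := 1 / 26) (by norm_num)
  obtain ⟨x₀, hx₀2, hθQ⟩ := chebyshevTheta_eventually_ge (η := 1 / 26) (by norm_num)
  set a : ℝ := max a₂ (max a₃ a₄) with ha_def
  have ha2 : a₂ ≤ a := le_max_left _ _
  have ha3 : a₃ ≤ a := le_trans (le_max_left _ _) (le_max_right _ _)
  have ha4 : a₄ ≤ a := le_trans (le_max_right _ _) (le_max_right _ _)
  have ha1 : 1 ≤ a := le_trans ha₂ ha2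
  obtain ⟨L, hL, hthr⟩ := exists_exponent_rpow 30 a x₀ 4200 (by norm_num) (by linarith)
  refine ⟨L, hL, fun K _ _ h4 hS4 x hxL => ?_⟩
  -- the closure and the three subfields
  obtain ⟨N, _, _, hGal, h24, K', e, ψ, hstab, hdN⟩ := quarticS4Closure K h4 hS4
  haveI := hGal
  obtain ⟨A, D, hA, hD, hS, hineq⟩ := exists_quartic_subgroups ψ K'.fixingSubgroup hstab
  set k := IntermediateField.fixedField A with hk_def
  set K₃ := IntermediateField.fixedField D with hK₃_def
  have hk : Module.finrank ℚ k = 2 := by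
    have h1 : Module.finrank k N = 12 := by
      rw [hk_def, IntermediateField.finrank_fixedField_eq_card, hA]
    have h2 := Module.finrank_mul_finrank ℚ k N
    rw [h1, h24] at h2
    omega
  have hK₃ : Module.finrank ℚ K₃ = 3 := by
    have h1 : Module.finrank K₃ N = 8 := by
      rw [hK₃_def, IntermediateField.finrank_fixedField_eq_card, hD]
    have h2 := Module.finrank_mul_finrank ℚ K₃ N
    rw [h1, h24] at h2
    omega
  have hK' : Module.finrank ℚ K' = 4 := by rw [← e.toLinearEquiv.finrank_eq, h4]
  have hdisc' : NumberField.discr K' = NumberField.discr K :=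
    (NumberField.discr_eq_discr_of_algEquiv K e).symm
  -- sizes
  set d : ℝ := ((NumberField.discr K).natAbs : ℝ) with hd
  have hd3 : (3 : ℝ) ≤ d := three_le_natAbs_discr_real K (by rw [h4]; norm_num)
  have hd0 : (0 : ℝ) < d := by linarith
  obtain ⟨hx₀, hxQ, hxB⟩ := hthr d hd3
  -- discriminants and conductors of the subfields
  have hdE : ∀ E : IntermediateField ℚ N, ((NumberField.discr E).natAbs : ℝ) ≤ d ^ (24 : ℕ) := by
    intro E
    have hdvd := NumberField.discr_dvd_discr E N
    have h1 : (NumberField.discr E).natAbs ≤ (NumberField.discr N).natAbs :=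
      Nat.le_of_dvd (Int.natAbs_pos.mpr (NumberField.discr_ne_zero N)) (Int.natAbs_dvd_natAbs.mpr hdvd)
    rw [hd]
    exact_mod_cast h1.trans hdN
  have hd30 : (1 : ℝ) ≤ d ^ (30 : ℝ) := Real.one_le_rpow (by linarith) (by norm_num)
  have hQx : ∀ (E : IntermediateField ℚ N) (b : ℝ), 0 ≤ b → b ≤ a → Module.finrank ℚ E ≤ 4 →
      ThornerZaman.condQn E ^ b ≤ x := by
    intro E b hb hba hn
    have hQ := condQn_le_pow_thirty hd3 (hdE E) hn
    have hQ0 : 0 ≤ ThornerZaman.condQn E := by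
      rw [ThornerZaman.condQn]; positivity
    calc ThornerZaman.condQn E ^ b ≤ (d ^ (30 : ℝ)) ^ b := Real.rpow_le_rpow hQ0 hQ (hb)
      _ ≤ (d ^ (30 : ℝ)) ^ a := Real.rpow_le_rpow_of_exponent_le hd30 hba
      _ ≤ d ^ L := hxQ
      _ ≤ x := hxL
  -- the analytic inputs at `x`
  have hθ : 25 / 26 * x ≤ Chebyshev.theta x := by
    have := hθQ x (hx₀.trans hxL); norm_num at this ⊢; linarith
  have hθk : degreeOneTheta k x ≤ 27 / 26 * x := by
    have := (degreeOneTheta_le_chebyshevThetaIdeal k x).trans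
      (hup2 k hk x (hQx k a₂ (by linarith) ha2 (by omega)))
    norm_num at this ⊢; linarith
  have hθ3 : degreeOneTheta K₃ x ≤ 27 / 26 * x := by
    have := (degreeOneTheta_le_chebyshevThetaIdeal K₃ x).trans
      (hup3 K₃ hK₃ x (hQx K₃ a₃ (by linarith) ha3 (by omega)))
    norm_num at this ⊢; linarith
  have hθK : degreeOneTheta K' x ≤ 27 / 26 * x := by
    have := (degreeOneTheta_le_chebyshevThetaIdeal K' x).trans
      (hup4 K' hK' x (hQx K' a₄ (by linarith) ha4 hK'.le))
    norm_num at this ⊢; linarith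
  have hlogN : 7 * Real.log ((NumberField.discr N).natAbs : ℝ) ≤ x / 25 := by
    have := log_natAbs_discr_le hdN
    push_cast at this
    linarith
  -- the sum over the inert primes of `K'` avoiding `d_N`, and over the inert primes of `K`
  have hsum := seven_mul_quarticInertSum_ge A D K' hA hD hS hineq x
  have hsub : ∑ p ∈ (Nat.primesLE ⌊x⌋₊).filter
      (fun p : ℕ => ¬ ((p : ℤ) ∣ NumberField.discr N) ∧
        ((splittingType K' p).filter (· ∣ 2)).sum = 0), Real.log p ≤
      ∑ p ∈ (Nat.primesLE ⌊x⌋₊).filter (fun p : ℕ => (Ideal.span {(p : 𝓞 K)}).IsPrime), Real.log p := by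
    refine Finset.sum_le_sum_of_subset_of_nonneg ?_ fun p _ _ => Real.log_natCast_nonneg p
    intro p hp
    rw [Finset.mem_filter] at hp ⊢
    obtain ⟨hpmem, hpN, hcount⟩ := hp
    have hp' := (Nat.mem_primesLE.mp hpmem).2
    have hdvd : ¬ ((p : ℤ) ∣ NumberField.discr K) := fun h =>
      hpN (h.trans (hdisc' ▸ NumberField.discr_dvd_discr K' N))
    refine ⟨hpmem, isPrime_span_of_sum_filter_dvd_two_eq_zero h4 hp' hdvd ?_⟩
    rw [ArithmeticallyEquivalent.of_algEquiv e p hp']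
    exact hcount
  linarith

/-- `Σ_{p ∈ F} log p ≤ #F · log x` for a set `F` of primes `p ≤ x`. -/
private theorem sum_log_le_card_mul_log {x : ℝ} (hx : 1 ≤ x) (F : Finset ℕ)
    (hF : F ⊆ Nat.primesLE ⌊x⌋₊) : ∑ p ∈ F, Real.log p ≤ F.card * Real.log x := by
  have h : ∀ p ∈ F, Real.log p ≤ Real.log x := by
    intro p hp
    have hp := Nat.mem_primesLE.mp (hF hp)
    have hp0 : (0 : ℝ) < p := by exact_mod_cast hp.2.pos
    have hpx : (p : ℝ) ≤ x := (Nat.cast_le.mpr hp.1).trans (Nat.floor_le (by linarith))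
    exact Real.log_le_log hp0 hpx
  have := Finset.sum_le_card_nsmul F (fun p => Real.log p) (Real.log x) h
  rwa [nsmul_eq_mul] at this

open scoped Classical in
/-- **The number of inert primes of an `S₄`-quartic field in the Linnik range** (`π`-form): there is
`L > 0` such that for every quartic field `K` with Galois closure of group `S₄` and every `x ≥ |d_K|^L`,
`#{p ≤ x : p𝓞_K prime} ≥ x / (16 log x)` — the order of magnitude of the Chebotarev density theorem
(density `1/4`), unconditionally. [cite: LagariasMontgomeryOdlyzko1979, Theorem 1.1]
[cite: ThornerZaman2019, Theorem 1.1] -/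
theorem card_inertPrimes_ge_of_quartic_S4 :
    ∃ L : ℝ, 0 < L ∧ ∀ (K : Type) [Field K] [NumberField K], Module.finrank ℚ K = 4 →
      (∀ (M : Type) [Field M] [NumberField M] [IsGalois ℚ M],
        (K →ₐ[ℚ] M) → 24 ≤ Module.finrank ℚ M) →
        ∀ x : ℝ, ((NumberField.discr K).natAbs : ℝ) ^ L ≤ x →
          x / (16 * Real.log x) ≤
            (((Nat.primesLE ⌊x⌋₊).filter (fun p : ℕ => (Ideal.span {(p : 𝓞 K)}).IsPrime)).card : ℝ) := by
  obtain ⟨L, hL, h⟩ := inertSum_ge_of_quartic_S4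
  refine ⟨L, hL, fun K _ _ h4 hS4 x hxL => ?_⟩
  have hsum := h K h4 hS4 x hxL
  have hd3 : (3 : ℝ) ≤ ((NumberField.discr K).natAbs : ℝ) :=
    three_le_natAbs_discr_real K (by rw [h4]; norm_num)
  have hx1 : 1 < x := by
    have h3L : (1 : ℝ) < ((NumberField.discr K).natAbs : ℝ) ^ L := Real.one_lt_rpow (by linarith) hL
    linarith
  have hlog : 0 < Real.log x := Real.log_pos hx1
  have hcard := sum_log_le_card_mul_log hx1.le
    ((Nat.primesLE ⌊x⌋₊).filter (fun p : ℕ => (Ideal.span {(p : 𝓞 K)}).IsPrime)) (Finset.filter_subset _ _)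
  rw [div_le_iff₀ (by positivity)]
  calc x = x / 16 * 16 := by ring
    _ ≤ (∑ p ∈ (Nat.primesLE ⌊x⌋₊).filter (fun p : ℕ => (Ideal.span {(p : 𝓞 K)}).IsPrime),
          Real.log p) * 16 := by nlinarith
    _ ≤ _ := by nlinarith

end Summit.QuantumAdvantage.QuantumAdvantage.Theorems.DegreeOnePrimesEscape

end
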